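import Literature.Topology.FourManifolds.WhiteheadExtendH
import HarnessLib

/-!
# Whitehead triangulations, the extension step (Munkres 10.4), part X4a: the glued complex `G₃`

Continuation of `WhiteheadExtendH`.  The unchanged simplices `U` of the trimmed complex `K''`
(those vertex-disjoint from the simplices of `T₁`; this includes every non-straight simplex) live
in `ℝᴺ`, the new chart-space complex `H` lives in `𝔼 n`, and the two are glued along the kept
straight simplices.  We realise the glued complex geometrically in
`V₃ = ℝᴺ × (𝔼 n × ℝ)`: an old vertex `v` becomes `(v, 0, 1)`, a vertex of `H` which is the image
`Λ v` of a straight vertex `v` becomes `(v, 0, 1)` as well, and every other vertex `z` of `H`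
becomes `(0, z, 0)` (`psi`).  The resulting family of simplices `G₃` is a finite geometric
simplicial complex (`G₃`): affine independence and the intersection property are checked by
separating the last coordinate and using the geometry of `K''` in `ℝᴺ` and of `H` in `𝔼 n`; the
key input is that the straight vertices carried by a simplex of `H` span a face of a simplex of
`K''` (`exists_superset_sv`).

No named facts are introduced.
-/

open Set Function Metric Filter
open scoped Topology NNReal Manifold

noncomputable section

-- `[T2Space M]` is a section variable used by most lemmas below; per-lemma `omit` would be noise.
set_option linter.unusedSectionVars false

namespace Literature.Topology.FourManifolds

open Literature.Analysis.Convexity Literature.Analysis.Convexity.SignArrangement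

local notation "𝔼 " n:arg => EuclideanSpace ℝ (Fin n)

/-- The ambient space of the glued complex: `ℝᴺ × (𝔼 n × ℝ)`. [folklore] -/
abbrev V₃ (n N : ℕ) : Type := (Fin N → ℝ) × (EuclideanSpace ℝ (Fin n) × ℝ)

section Vertices

variable {n N : ℕ}

/-- An old vertex `v ↦ (v, 0, 1)`. [folklore] -/
def oldV (v : Fin N → ℝ) : V₃ n N := (v, 0, 1)

/-- A new vertex `z ↦ (0, z, 0)`. [folklore] -/
def newV (z : 𝔼 n) : V₃ n N := (0, z, 0)

/-- Auxiliary (`oldV_fst`). [folklore] -/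
@[simp] theorem oldV_fst (v : Fin N → ℝ) : (oldV (n := n) v).1 = v := rfl

/-- Auxiliary (`oldV_snd_fst`). [folklore] -/
@[simp] theorem oldV_snd_fst (v : Fin N → ℝ) : (oldV (n := n) v).2.1 = 0 := rfl

/-- Auxiliary (`oldV_snd_snd`). [folklore] -/
@[simp] theorem oldV_snd_snd (v : Fin N → ℝ) : (oldV (n := n) v).2.2 = 1 := rfl

/-- Auxiliary (`newV_fst`). [folklore] -/
@[simp] theorem newV_fst (z : 𝔼 n) : (newV (N := N) z).1 = 0 := rfl

/-- Auxiliary (`newV_snd_fst`). [folklore] -/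
@[simp] theorem newV_snd_fst (z : 𝔼 n) : (newV (N := N) z).2.1 = z := rfl

/-- Auxiliary (`newV_snd_snd`). [folklore] -/
@[simp] theorem newV_snd_snd (z : 𝔼 n) : (newV (N := N) z).2.2 = 0 := rfl

/-- Auxiliary (`oldV_injective`). [folklore] -/
theorem oldV_injective : Injective (oldV (n := n) (N := N)) := fun v w h => by
  have := congr_arg Prod.fst h; simpa using this

/-- Auxiliary (`newV_injective`). [folklore] -/
theorem newV_injective : Injective (newV (n := n) (N := N)) := fun z w h => by
  have := congr_arg (fun x : V₃ n N => x.2.1) h; simpa using this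

/-- Auxiliary (`oldV_ne_newV`). [folklore] -/
theorem oldV_ne_newV (v : Fin N → ℝ) (z : 𝔼 n) : oldV v ≠ newV z := fun h => by
  have := congr_arg (fun x : V₃ n N => x.2.2) h; simp at this

/-- The embedding of the old space as an affine map. [folklore] -/
def oldAff : (Fin N → ℝ) →ᵃ[ℝ] V₃ n N :=
  (LinearMap.inl ℝ (Fin N → ℝ) (EuclideanSpace ℝ (Fin n) × ℝ)).toAffineMap +
    AffineMap.const ℝ (Fin N → ℝ) ((0, 0, 1) : V₃ n N)

/-- Auxiliary (`oldAff_apply`). [folklore] -/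
theorem oldAff_apply (v : Fin N → ℝ) : oldAff (n := n) v = oldV v := by
  simp only [oldAff, AffineMap.coe_add, Pi.add_apply, LinearMap.coe_toAffineMap, LinearMap.inl_apply,
    AffineMap.const_apply, oldV, Prod.mk_add_mk, add_zero, zero_add]

end Vertices

namespace BendInput

variable {n N : ℕ} {M : Type*} [TopologicalSpace M] [T2Space M] {I : BendInput n N M}

namespace BendSetup

variable (S : BendSetup I)

/-! ### Straight vertices and the vertex translation `psi` -/

/-- The vertices of the straight simplices. [folklore] -/
def StrVert : Set (Fin N → ℝ) := {v | ∃ t ∈ S.Str, v ∈ t}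

/-- Auxiliary (`strVert_finite`). [folklore] -/
theorem strVert_finite : S.StrVert.Finite := by
  have : S.StrVert ⊆ ⋃ t ∈ S.Str, (t : Set (Fin N → ℝ)) := fun v ⟨t, ht, hv⟩ => mem_biUnion ht hv
  exact (S.strCx_finite.biUnion fun t _ => t.finite_toSet).subset this

/-- Straight vertices lie in the straight part. [folklore] -/
theorem mem_space_of_strVert {v : Fin N → ℝ} (hv : v ∈ S.StrVert) : v ∈ S.StrCx.space := by
  obtain ⟨t, ht, hvt⟩ := hv
  exact S.mem_strCx_space_of_mem ht hvt

/-- The singleton of a straight vertex is a straight simplex. [folklore] -/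
theorem singleton_str {v : Fin N → ℝ} (hv : v ∈ S.StrVert) : ({v} : Finset (Fin N → ℝ)) ∈ S.Str := by
  obtain ⟨t, ht, hvt⟩ := hv
  exact S.str_down t ht {v} (Finset.singleton_subset_iff.2 hvt) (Finset.singleton_nonempty v)

open Classical in
/-- **The vertex translation**: a vertex of `H` which is the image `Λ v` of a straight vertex `v`
goes to the old vertex `(v, 0, 1)`, any other point `z` to the new vertex `(0, z, 0)`. [folklore] -/
def psi (p : 𝔼 n) : V₃ n N :=
  if h : ∃ v, v ∈ S.StrVert ∧ S.Λ v = p then oldV h.choose else newV p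

/-- Auxiliary (`psi_Λ`). [folklore] -/
theorem psi_Λ {v : Fin N → ℝ} (hv : v ∈ S.StrVert) : S.psi (S.Λ v) = oldV v := by
  have h : ∃ v', v' ∈ S.StrVert ∧ S.Λ v' = S.Λ v := ⟨v, hv, rfl⟩
  simp only [psi, dif_pos h]
  congr 1
  exact S.injOn_Λ_str (S.mem_space_of_strVert h.choose_spec.1) (S.mem_space_of_strVert hv) h.choose_spec.2

/-- Auxiliary (`psi_of_not`). [folklore] -/
theorem psi_of_not {p : 𝔼 n} (h : ¬∃ v, v ∈ S.StrVert ∧ S.Λ v = p) : S.psi p = newV p := by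
  simp only [psi, dif_neg h]

/-- The two kinds of values of `psi`. [folklore] -/
theorem psi_cases (p : 𝔼 n) : (∃ v ∈ S.StrVert, S.Λ v = p ∧ S.psi p = oldV v) ∨
    ((¬∃ v, v ∈ S.StrVert ∧ S.Λ v = p) ∧ S.psi p = newV p) := by
  by_cases h : ∃ v, v ∈ S.StrVert ∧ S.Λ v = p
  · obtain ⟨v, hv, rfl⟩ := h
    exact Or.inl ⟨v, hv, rfl, S.psi_Λ hv⟩
  · exact Or.inr ⟨h, S.psi_of_not h⟩

/-- **`psi` is injective.** [folklore] -/
theorem psi_injective : Injective S.psi := by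
  intro p q hpq
  rcases S.psi_cases p with ⟨v, hv, rfl, hp⟩ | ⟨hnp, hp⟩ <;> rcases S.psi_cases q with ⟨w, hw, rfl, hq⟩ | ⟨hnq, hq⟩
  · rw [hp, hq] at hpq; rw [oldV_injective hpq]
  · rw [hp, hq] at hpq; exact absurd hpq (oldV_ne_newV _ _)
  · rw [hp, hq] at hpq; exact absurd hpq.symm (oldV_ne_newV _ _)
  · rw [hp, hq] at hpq; exact newV_injective hpq

/-- The straight vertices carried by a finite set of chart points. [folklore] -/
def sv (ρ : Finset (𝔼 n)) : Finset (Fin N → ℝ) := S.strVert_finite.toFinset.filter fun v => S.Λ v ∈ ρ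

/-- Auxiliary (`mem_sv`). [folklore] -/
theorem mem_sv {ρ : Finset (𝔼 n)} {v : Fin N → ℝ} : v ∈ S.sv ρ ↔ v ∈ S.StrVert ∧ S.Λ v ∈ ρ := by
  simp [sv, S.strVert_finite.mem_toFinset]

/-- A vertex of `K''` lying in the closed simplex of a simplex of `K''` is one of its vertices.
[folklore] -/
theorem mem_of_mem_convexHull_Kb {v : Fin N → ℝ} (hv : ({v} : Finset (Fin N → ℝ)) ∈ S.Kb.faces)
    {u : Finset (Fin N → ℝ)} (hu : u ∈ S.Kb.faces) (h : v ∈ convexHull ℝ (u : Set (Fin N → ℝ))) : v ∈ u := by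
  classical
  have h1 : v ∈ convexHull ℝ (↑({v} : Finset (Fin N → ℝ)) : Set (Fin N → ℝ)) ∩ convexHull ℝ (u : Set (Fin N → ℝ)) :=
    ⟨subset_convexHull ℝ _ (by simp), h⟩
  have h2 := S.Kb.inter_subset_convexHull hv hu h1
  by_contra hvu
  have : (↑({v} : Finset (Fin N → ℝ)) : Set (Fin N → ℝ)) ∩ ↑u = ∅ := by
    ext w; simp only [Finset.coe_singleton, mem_inter_iff, mem_singleton_iff, Finset.mem_coe,
      mem_empty_iff_false, iff_false, not_and]
    rintro rfl; exact hvu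
  rw [this, convexHull_empty] at h2
  exact h2

/-- Straight vertices whose images lie in the image of a straight simplex belong to it. [folklore] -/
theorem mem_of_Λ_mem_image {v : Fin N → ℝ} (hv : v ∈ S.StrVert) {u₀ : Finset (Fin N → ℝ)} (hu₀ : u₀ ∈ S.Str)
    (h : S.Λ v ∈ S.Λ '' convexHull ℝ (u₀ : Set (Fin N → ℝ))) : v ∈ u₀ := by
  obtain ⟨x, hx, hxe⟩ := h
  have hvx : v = x := S.injOn_Λ_str (S.mem_space_of_strVert hv) (S.StrCx.convexHull_subset_space hu₀ hx) hxe.symm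
  subst hvx
  exact S.mem_of_mem_convexHull_Kb (S.singleton_str hv).1 hu₀.1 hx

/-- An old face: the lift of an unchanged simplex. [folklore] -/
def oldFace (_S : BendSetup I) (σ : Finset (Fin N → ℝ)) : Finset (V₃ n N) := σ.image oldV

/-- A new face: the translation of a simplex of `H`. [folklore] -/
def newFace (ρ : Finset (𝔼 n)) : Finset (V₃ n N) := ρ.image S.psi

/-- Auxiliary (`mem_oldFace`). [folklore] -/
theorem mem_oldFace {σ : Finset (Fin N → ℝ)} {x : V₃ n N} : x ∈ S.oldFace σ ↔ ∃ v ∈ σ, oldV v = x := by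
  simp [oldFace]

/-- Auxiliary (`mem_newFace`). [folklore] -/
theorem mem_newFace {ρ : Finset (𝔼 n)} {x : V₃ n N} : x ∈ S.newFace ρ ↔ ∃ p ∈ ρ, S.psi p = x := by
  simp [newFace]

/-- Auxiliary (`coe_oldFace`). [folklore] -/
theorem coe_oldFace (σ : Finset (Fin N → ℝ)) : ((S.oldFace σ : Finset (V₃ n N)) : Set (V₃ n N)) = oldV '' (σ : Set (Fin N → ℝ)) := by
  simp [oldFace]

/-- The closed old face is the lift of the closed simplex. [folklore] -/
theorem convexHull_oldFace (σ : Finset (Fin N → ℝ)) :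
    convexHull ℝ ((S.oldFace σ : Finset (V₃ n N)) : Set (V₃ n N)) = oldV '' convexHull ℝ (σ : Set (Fin N → ℝ)) := by
  have h1 : (oldV : (Fin N → ℝ) → V₃ n N) = ⇑(oldAff (n := n) (N := N)) := funext fun v => (oldAff_apply v).symm
  rw [coe_oldFace, h1, ← AffineMap.image_convexHull]

/-- The old part of the translation of a new face: `sv`. [folklore] -/
theorem oldV_mem_newFace_iff {ρ : Finset (𝔼 n)} {v : Fin N → ℝ} (hv : v ∈ S.StrVert) :
    oldV v ∈ S.newFace ρ ↔ S.Λ v ∈ ρ := by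
  rw [mem_newFace]
  constructor
  · rintro ⟨p, hp, hpx⟩
    rcases S.psi_cases p with ⟨w, hw, rfl, hψ⟩ | ⟨-, hψ⟩
    · rw [hψ] at hpx
      rwa [← oldV_injective hpx]
    · rw [hψ] at hpx; exact absurd hpx.symm (oldV_ne_newV _ _)
  · intro h; exact ⟨S.Λ v, h, S.psi_Λ hv⟩

open Classical in
/-- The new (non-straight) vertices of a finite set of chart points. [folklore] -/
def nw (ρ : Finset (𝔼 n)) : Finset (𝔼 n) := ρ.filter fun p => ¬∃ v, v ∈ S.StrVert ∧ S.Λ v = p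

/-- Auxiliary (`mem_nw`). [folklore] -/
theorem mem_nw {ρ : Finset (𝔼 n)} {p : 𝔼 n} : p ∈ S.nw ρ ↔ p ∈ ρ ∧ ¬∃ v, v ∈ S.StrVert ∧ S.Λ v = p := by
  simp [nw]

/-- `Λ` is injective on straight vertices. [folklore] -/
theorem injOn_Λ_strVert : InjOn S.Λ S.StrVert := fun _ hv _ hw h =>
  S.injOn_Λ_str (S.mem_space_of_strVert hv) (S.mem_space_of_strVert hw) h

/-- **Splitting a sum over `ρ`** into the straight part (re-indexed by `sv ρ`) and the new part.
[folklore] -/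
theorem sum_split {β : Type*} [AddCommMonoid β] (ρ : Finset (𝔼 n)) (g : 𝔼 n → β) :
    ∑ p ∈ ρ, g p = ∑ v ∈ S.sv ρ, g (S.Λ v) + ∑ p ∈ S.nw ρ, g p := by
  classical
  have hdisj : Disjoint ((S.sv ρ).image S.Λ) (S.nw ρ) := by
    rw [Finset.disjoint_left]
    intro p hp hpn
    obtain ⟨v, hv, rfl⟩ := Finset.mem_image.1 hp
    exact (S.mem_nw.1 hpn).2 ⟨v, (S.mem_sv.1 hv).1, rfl⟩
  have hunion : (S.sv ρ).image S.Λ ∪ S.nw ρ = ρ := by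
    ext p
    simp only [Finset.mem_union, Finset.mem_image, mem_nw, mem_sv]
    constructor
    · rintro (⟨v, ⟨-, hvρ⟩, rfl⟩ | ⟨hp, -⟩)
      · exact hvρ
      · exact hp
    · intro hp
      by_cases h : ∃ v, v ∈ S.StrVert ∧ S.Λ v = p
      · obtain ⟨v, hv, rfl⟩ := h
        exact Or.inl ⟨v, ⟨hv, hp⟩, rfl⟩
      · exact Or.inr ⟨hp, h⟩
  calc ∑ p ∈ ρ, g p = ∑ p ∈ (S.sv ρ).image S.Λ ∪ S.nw ρ, g p := by rw [hunion]
    _ = ∑ p ∈ (S.sv ρ).image S.Λ, g p + ∑ p ∈ S.nw ρ, g p := Finset.sum_union hdisj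
    _ = ∑ v ∈ S.sv ρ, g (S.Λ v) + ∑ p ∈ S.nw ρ, g p := by
        rw [Finset.sum_image fun v hv w hw h => S.injOn_Λ_strVert (S.mem_sv.1 hv).1 (S.mem_sv.1 hw).1 h]

/-- **Components of a combination of translated vertices.** [folklore] -/
theorem components_sum (ρ : Finset (𝔼 n)) (c : 𝔼 n → ℝ) :
    (∑ p ∈ ρ, c p • S.psi p).1 = ∑ v ∈ S.sv ρ, c (S.Λ v) • v ∧
    (∑ p ∈ ρ, c p • S.psi p).2.1 = ∑ p ∈ S.nw ρ, c p • p ∧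
    (∑ p ∈ ρ, c p • S.psi p).2.2 = ∑ v ∈ S.sv ρ, c (S.Λ v) := by
  have hold : ∀ v ∈ S.sv ρ, c (S.Λ v) • S.psi (S.Λ v) = ((c (S.Λ v) • v, 0, c (S.Λ v)) : V₃ n N) := fun v hv => by
    rw [S.psi_Λ (S.mem_sv.1 hv).1, oldV]
    ext <;> simp
  have hnew : ∀ p ∈ S.nw ρ, c p • S.psi p = ((0, c p • p, 0) : V₃ n N) := fun p hp => by
    rw [S.psi_of_not (S.mem_nw.1 hp).2, newV]
    ext <;> simp
  rw [S.sum_split ρ (fun p => c p • S.psi p), Finset.sum_congr rfl hold, Finset.sum_congr rfl hnew]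
  refine ⟨?_, ?_, ?_⟩
  · rw [Prod.fst_add, Prod.fst_sum, Prod.fst_sum]; simp
  · rw [Prod.snd_add, Prod.snd_sum, Prod.snd_sum, Prod.fst_add, Prod.fst_sum, Prod.fst_sum]; simp
  · rw [Prod.snd_add, Prod.snd_sum, Prod.snd_sum, Prod.snd_add, Prod.snd_sum, Prod.snd_sum]; simp

/-- Points of a closed new face: convex combinations of the translated vertices. [folklore] -/
theorem exists_rep_of_mem_convexHull_newFace {ρ : Finset (𝔼 n)} {x : V₃ n N}
    (hx : x ∈ convexHull ℝ ((S.newFace ρ : Finset (V₃ n N)) : Set (V₃ n N))) :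
    ∃ c : 𝔼 n → ℝ, (∀ p ∈ ρ, 0 ≤ c p) ∧ ∑ p ∈ ρ, c p = 1 ∧ ∑ p ∈ ρ, c p • S.psi p = x := by
  classical
  obtain ⟨w, hw0, hw1, hwx⟩ := Finset.mem_convexHull'.1 hx
  refine ⟨fun p => w (S.psi p), fun p hp => hw0 _ (S.mem_newFace.2 ⟨p, hp, rfl⟩), ?_, ?_⟩
  · rw [← hw1, newFace, Finset.sum_image fun p _ q _ h => S.psi_injective h]
  · rw [← hwx, newFace, Finset.sum_image fun p _ q _ h => S.psi_injective h]

/-- Convex combinations of the translated vertices lie in the closed new face. [folklore] -/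
theorem sum_mem_convexHull_newFace {ρ : Finset (𝔼 n)} {c : 𝔼 n → ℝ} (hc0 : ∀ p ∈ ρ, 0 ≤ c p)
    (hc1 : ∑ p ∈ ρ, c p = 1) : ∑ p ∈ ρ, c p • S.psi p ∈ convexHull ℝ ((S.newFace ρ : Finset (V₃ n N)) : Set (V₃ n N)) :=
  (convex_convexHull ℝ _).sum_mem hc0 hc1 fun p hp => subset_convexHull ℝ _ (S.mem_newFace.2 ⟨p, hp, rfl⟩)

/-- Points of a closed old face. [folklore] -/
theorem mem_convexHull_oldFace_iff {σ : Finset (Fin N → ℝ)} {x : V₃ n N} :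
    x ∈ convexHull ℝ ((S.oldFace σ : Finset (V₃ n N)) : Set (V₃ n N)) ↔
      ∃ w ∈ convexHull ℝ (σ : Set (Fin N → ℝ)), oldV w = x := by
  rw [S.convexHull_oldFace]; rfl

/-- Old faces are affinely independent. [folklore] -/
theorem affineIndependent_oldFace {σ : Finset (Fin N → ℝ)} (hσ : σ ∈ S.Kb.faces) :
    AffineIndependent ℝ ((↑) : ↥(S.oldFace σ) → V₃ n N) := by
  classical
  have hinj : InjOn (oldAff (n := n) (N := N)) (convexHull ℝ (σ : Set (Fin N → ℝ))) := fun v _ w _ h => by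
    rw [oldAff_apply, oldAff_apply] at h; exact oldV_injective h
  have h := affineIndependent_image_of_injOn (S.Kb.indep hσ) (oldAff (n := n) (N := N)) hinj
  have heq : σ.image (oldAff (n := n) (N := N)) = S.oldFace σ := by
    unfold oldFace
    exact Finset.image_congr fun v _ => oldAff_apply v
  rw [heq] at h
  exact h

/-- Auxiliary (`oldFace_inter`). [folklore] -/
theorem oldFace_inter (σ₁ σ₂ : Finset (Fin N → ℝ)) : S.oldFace (σ₁ ∩ σ₂) = S.oldFace σ₁ ∩ S.oldFace σ₂ := by
  classical
  unfold oldFace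
  exact Finset.image_inter _ _ oldV_injective

/-- Auxiliary (`newFace_inter`). [folklore] -/
theorem newFace_inter (ρ₁ ρ₂ : Finset (𝔼 n)) : S.newFace (ρ₁ ∩ ρ₂) = S.newFace ρ₁ ∩ S.newFace ρ₂ := by
  classical
  unfold newFace
  exact Finset.image_inter _ _ S.psi_injective

/-- **Old/old intersections.** [folklore] -/
theorem inter_old_old {σ₁ σ₂ : Finset (Fin N → ℝ)} (h₁ : σ₁ ∈ S.Kb.faces) (h₂ : σ₂ ∈ S.Kb.faces) :
    convexHull ℝ ((S.oldFace σ₁ : Finset (V₃ n N)) : Set (V₃ n N)) ∩ convexHull ℝ ((S.oldFace σ₂ : Finset (V₃ n N)) : Set (V₃ n N)) ⊆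
      convexHull ℝ ((↑(S.oldFace σ₁ ∩ S.oldFace σ₂)) : Set (V₃ n N)) := by
  rintro x ⟨hx₁, hx₂⟩
  obtain ⟨w₁, hw₁, rfl⟩ := S.mem_convexHull_oldFace_iff.1 hx₁
  obtain ⟨w₂, hw₂, heq⟩ := S.mem_convexHull_oldFace_iff.1 hx₂
  have hww : w₂ = w₁ := oldV_injective heq
  subst hww
  have hw : w₂ ∈ convexHull ℝ (↑(σ₁ ∩ σ₂) : Set (Fin N → ℝ)) := by
    rw [Finset.coe_inter]; exact S.Kb.inter_subset_convexHull h₁ h₂ ⟨hw₁, hw₂⟩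
  rw [← oldFace_inter, S.mem_convexHull_oldFace_iff]
  exact ⟨w₂, hw, rfl⟩

variable {S} (X : ExtInput S)

namespace ExtInput

/-! ### Unchanged simplices and the straight part of a simplex of `H` -/

/-- The unchanged simplices: vertex-disjoint from the simplices of `T₁`. [folklore] -/
def U : Set (Finset (Fin N → ℝ)) := {σ | σ ∈ S.Kb.faces ∧ ∀ t ∈ X.T₁, Disjoint σ t}

/-- Auxiliary (`u_subset`). [folklore] -/
theorem u_subset : X.U ⊆ S.Kb.faces := fun _ h => h.1

/-- Auxiliary (`u_down`). [folklore] -/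
theorem u_down : ∀ σ ∈ X.U, ∀ σ' ⊆ σ, σ'.Nonempty → σ' ∈ X.U := fun _ hσ _ hσ' hne =>
  ⟨S.Kb.down_closed hσ.1 hσ' hne, fun t ht => Finset.disjoint_of_subset_left hσ' (hσ.2 t ht)⟩

/-- **Non-straight simplices are unchanged.** [folklore] -/
theorem mem_U_of_not_str {σ : Finset (Fin N → ℝ)} (hσ : σ ∈ S.Kb.faces) (hns : σ ∉ S.Str) : σ ∈ X.U := by
  refine ⟨hσ, fun t ht => ?_⟩
  rw [Finset.disjoint_iff_inter_eq_empty]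
  by_contra hne
  exact hns (X.str_of_inter_T₁ hσ ht (Finset.nonempty_iff_ne_empty.2 hne))

/-- **The straight vertices carried by a simplex of `H` span a face of a straight simplex.**
[folklore] -/
theorem exists_superset_sv {ρ : Finset (𝔼 n)} (hρ : ρ ∈ X.H.faces) (hne : (S.sv ρ).Nonempty) :
    ∃ u₀ ∈ S.Str, S.sv ρ ⊆ u₀ := by
  -- first: if `conv ρ ⊆ Λ '' conv u₀` for a straight `u₀`, then `sv ρ ⊆ u₀`
  have key : ∀ u₀ ∈ S.Str, convexHull ℝ (ρ : Set (𝔼 n)) ⊆ S.Λ '' convexHull ℝ (u₀ : Set (Fin N → ℝ)) →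
      S.sv ρ ⊆ u₀ := fun u₀ hu₀ hsub v hv => by
    obtain ⟨hvs, hvρ⟩ := S.mem_sv.1 hv
    exact S.mem_of_Λ_mem_image hvs hu₀ (hsub (subset_convexHull ℝ _ hvρ))
  rcases X.mem_H_faces.1 hρ with hK | hB
  · rcases X.K'_refines hK with ⟨s, ⟨t, ht, σ₀, hσ₀t, hσ₀ne, rfl⟩, hsub⟩ | ⟨u, hu, -, hsub⟩
    · have hσ₀ : σ₀ ∈ S.Str := X.str_of_subset_T₁ ht hσ₀t hσ₀ne
      rw [S.convexHull_rIm hσ₀] at hsub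
      exact ⟨σ₀, hσ₀, key σ₀ hσ₀ hsub⟩
    · obtain ⟨u₀, hu₀, rfl⟩ := S.mem_Q_faces.1 hu
      rw [S.Q_hull hu₀] at hsub
      exact ⟨u₀, hu₀, key u₀ hu₀ hsub⟩
  · -- box simplex: either inside an image simplex of `T₁`, or carrying at most one straight vertex
    rcases X.Ph_inside hB.1 with hbox | ⟨t, ht, hsub⟩
    · obtain ⟨v, hv⟩ := hne
      refine ⟨{v}, S.singleton_str (S.mem_sv.1 hv).1, fun w hw => ?_⟩
      rw [Finset.mem_singleton]
      -- both `Λ v` and `Λ w` are vertices of `ρ` and arrangement vertices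
      obtain ⟨hvs, hvρ⟩ := S.mem_sv.1 hv
      obtain ⟨hws, hwρ⟩ := S.mem_sv.1 hw
      have hT : ∀ {x : Fin N → ℝ}, x ∈ S.StrVert → S.Λ x ∈ ρ → ∃ tx ∈ X.T₁, x ∈ tx := fun {x} hxs hxρ => by
        obtain ⟨tx, htx, hsub⟩ := X.exists_T₁_of_meets (S.singleton_str hxs)
          ⟨S.Λ x, ⟨x, subset_convexHull ℝ _ (by simp), rfl⟩, X.R₀_subset_RP (hbox (subset_convexHull ℝ _ hxρ))⟩
        exact ⟨tx, htx, hsub (Finset.mem_singleton_self x)⟩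
      obtain ⟨tv, htv, hvtv⟩ := hT hvs hvρ
      obtain ⟨tw, htw, hwtw⟩ := hT hws hwρ
      have hΛ := X.Ph_vertex_unique hB.1 htw htv hwtw hvtv hwρ hvρ
      exact S.injOn_Λ_str (S.mem_space_of_strVert hws) (S.mem_space_of_strVert hvs) hΛ
    · exact ⟨t, X.t₁_subset_str ht, key t (X.t₁_subset_str ht) hsub⟩

/-- The straight part of a simplex of `H` is a straight simplex (when nonempty). [folklore] -/
theorem sv_str {ρ : Finset (𝔼 n)} (hρ : ρ ∈ X.H.faces) (hne : (S.sv ρ).Nonempty) : S.sv ρ ∈ S.Str := by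
  obtain ⟨u₀, hu₀, hsub⟩ := X.exists_superset_sv hρ hne
  exact S.str_down u₀ hu₀ _ hsub hne

/-! ### The faces of the glued complex -/

/-- The faces of the glued complex. [folklore] -/
def G₃faces : Set (Finset (V₃ n N)) := (S.oldFace '' X.U) ∪ (S.newFace '' X.H.faces)

/-! ### Points of the closed faces -/

/-- **The chart value of a combination** of vertices of `ρ`: `∑ c p • p`; on the straight part it
is computed by `Λ`. If two combinations (over `ρ₁` and `ρ₂`, simplices of `H`) give the same point
of `V₃`, they give the same chart value ("`Λ` is a function on the straight part"). [folklore] -/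
theorem hval_eq {ρ₁ ρ₂ : Finset (𝔼 n)} (hρ₁ : ρ₁ ∈ X.H.faces) (hρ₂ : ρ₂ ∈ X.H.faces)
    {c d : 𝔼 n → ℝ} (hc0 : ∀ p ∈ ρ₁, 0 ≤ c p) (hd0 : ∀ p ∈ ρ₂, 0 ≤ d p)
    (heq : ∑ p ∈ ρ₁, c p • S.psi p = ∑ p ∈ ρ₂, d p • S.psi p) :
    ∑ p ∈ ρ₁, c p • p = ∑ p ∈ ρ₂, d p • p := by
  classical
  obtain ⟨h1c, h2c, h3c⟩ := S.components_sum ρ₁ c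
  obtain ⟨h1d, h2d, h3d⟩ := S.components_sum ρ₂ d
  have hW : ∑ v ∈ S.sv ρ₁, c (S.Λ v) • v = ∑ v ∈ S.sv ρ₂, d (S.Λ v) • v := by rw [← h1c, ← h1d, heq]
  have hE : ∑ p ∈ S.nw ρ₁, c p • p = ∑ p ∈ S.nw ρ₂, d p • p := by rw [← h2c, ← h2d, heq]
  have hr : ∑ v ∈ S.sv ρ₁, c (S.Λ v) = ∑ v ∈ S.sv ρ₂, d (S.Λ v) := by rw [← h3c, ← h3d, heq]
  -- the straight parts have equal `Λ`-images
  have hΛ : ∑ v ∈ S.sv ρ₁, c (S.Λ v) • S.Λ v = ∑ v ∈ S.sv ρ₂, d (S.Λ v) • S.Λ v := by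
    set r := ∑ v ∈ S.sv ρ₁, c (S.Λ v) with hrdef
    have hcv0 : ∀ v ∈ S.sv ρ₁, 0 ≤ c (S.Λ v) := fun v hv => hc0 _ (S.mem_sv.1 hv).2
    have hdv0 : ∀ v ∈ S.sv ρ₂, 0 ≤ d (S.Λ v) := fun v hv => hd0 _ (S.mem_sv.1 hv).2
    rcases (Finset.sum_nonneg hcv0).lt_or_eq with hrpos | hr0
    · -- normalise: a common point of two straight simplices
      have hne₁ : (S.sv ρ₁).Nonempty := by
        by_contra h; rw [Finset.not_nonempty_iff_eq_empty] at h
        rw [h, Finset.sum_empty] at hrpos; exact lt_irrefl _ hrpos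
      have hne₂ : (S.sv ρ₂).Nonempty := by
        by_contra h; rw [Finset.not_nonempty_iff_eq_empty] at h
        have h0 : ∑ v ∈ S.sv ρ₁, c (S.Λ v) = 0 := by rw [← hrdef, hr, h, Finset.sum_empty]
        rw [h0] at hrpos; exact lt_irrefl _ hrpos
      have hs₁ := X.sv_str hρ₁ hne₁
      have hs₂ := X.sv_str hρ₂ hne₂
      set y : Fin N → ℝ := ∑ v ∈ S.sv ρ₁, (r⁻¹ * c (S.Λ v)) • v with hy
      have hw₁ : ∑ v ∈ S.sv ρ₁, r⁻¹ * c (S.Λ v) = 1 := by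
        rw [← Finset.mul_sum, ← hrdef, inv_mul_cancel₀ (by rw [hrdef]; exact hrpos.ne')]
      have hw₂ : ∑ v ∈ S.sv ρ₂, r⁻¹ * d (S.Λ v) = 1 := by
        rw [← Finset.mul_sum, ← hr, inv_mul_cancel₀ (by rw [hrdef]; exact hrpos.ne')]
      have hy₂ : y = ∑ v ∈ S.sv ρ₂, (r⁻¹ * d (S.Λ v)) • v := by
        calc y = ∑ v ∈ S.sv ρ₁, r⁻¹ • (c (S.Λ v) • v) := Finset.sum_congr rfl fun v _ => mul_smul _ _ _
          _ = r⁻¹ • ∑ v ∈ S.sv ρ₁, c (S.Λ v) • v := (Finset.smul_sum).symm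
          _ = r⁻¹ • ∑ v ∈ S.sv ρ₂, d (S.Λ v) • v := by rw [hW]
          _ = ∑ v ∈ S.sv ρ₂, r⁻¹ • (d (S.Λ v) • v) := Finset.smul_sum
          _ = ∑ v ∈ S.sv ρ₂, (r⁻¹ * d (S.Λ v)) • v := Finset.sum_congr rfl fun v _ => (mul_smul _ _ _).symm
      have hy₁mem : y ∈ convexHull ℝ ((S.sv ρ₁ : Finset (Fin N → ℝ)) : Set (Fin N → ℝ)) :=
        (convex_convexHull ℝ _).sum_mem (fun v hv => mul_nonneg (inv_nonneg.2 hrpos.le) (hcv0 v hv)) hw₁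
          fun v hv => subset_convexHull ℝ _ hv
      have hy₂mem : y ∈ convexHull ℝ ((S.sv ρ₂ : Finset (Fin N → ℝ)) : Set (Fin N → ℝ)) := by
        rw [hy₂]
        exact (convex_convexHull ℝ _).sum_mem (fun v hv => mul_nonneg (inv_nonneg.2 hrpos.le) (hdv0 v hv)) hw₂
          fun v hv => subset_convexHull ℝ _ hv
      -- `Λ y` computed in the two straight simplices
      have e₁ : S.Λ y = ∑ v ∈ S.sv ρ₁, (r⁻¹ * c (S.Λ v)) • S.Λ v := by
        rw [S.Λ_eqOn hs₁.1.1 hy₁mem, hy]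
        exact affineMap_apply_sum_smul (A := S.A _ hs₁.1.1) (g := S.Λ)
          (fun v hv => (S.Λ_eqOn hs₁.1.1 (subset_convexHull ℝ _ hv)).symm) hw₁
      have e₂ : S.Λ y = ∑ v ∈ S.sv ρ₂, (r⁻¹ * d (S.Λ v)) • S.Λ v := by
        rw [S.Λ_eqOn hs₂.1.1 hy₂mem, hy₂]
        exact affineMap_apply_sum_smul (A := S.A _ hs₂.1.1) (g := S.Λ)
          (fun v hv => (S.Λ_eqOn hs₂.1.1 (subset_convexHull ℝ _ hv)).symm) hw₂
      have f₁ : r • S.Λ y = ∑ v ∈ S.sv ρ₁, c (S.Λ v) • S.Λ v := by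
        rw [e₁, Finset.smul_sum]
        refine Finset.sum_congr rfl fun v _ => ?_
        rw [smul_smul, ← mul_assoc, mul_inv_cancel₀ hrpos.ne', one_mul]
      have f₂ : r • S.Λ y = ∑ v ∈ S.sv ρ₂, d (S.Λ v) • S.Λ v := by
        rw [e₂, Finset.smul_sum]
        refine Finset.sum_congr rfl fun v _ => ?_
        rw [smul_smul, ← mul_assoc, mul_inv_cancel₀ hrpos.ne', one_mul]
      rw [← f₁, f₂]
    · -- `r = 0`: all straight coefficients vanish
      have hc00 : ∀ v ∈ S.sv ρ₁, c (S.Λ v) = 0 := (Finset.sum_eq_zero_iff_of_nonneg hcv0).1 hr0.symm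
      have hd00 : ∀ v ∈ S.sv ρ₂, d (S.Λ v) = 0 :=
        (Finset.sum_eq_zero_iff_of_nonneg hdv0).1 (by rw [← hr]; exact hr0.symm)
      rw [Finset.sum_eq_zero fun v hv => by rw [hc00 v hv, zero_smul],
        Finset.sum_eq_zero fun v hv => by rw [hd00 v hv, zero_smul]]
  calc ∑ p ∈ ρ₁, c p • p = ∑ v ∈ S.sv ρ₁, c (S.Λ v) • S.Λ v + ∑ p ∈ S.nw ρ₁, c p • p :=
        S.sum_split ρ₁ (fun p => c p • p)
    _ = ∑ v ∈ S.sv ρ₂, d (S.Λ v) • S.Λ v + ∑ p ∈ S.nw ρ₂, d p • p := by rw [hΛ, hE]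
    _ = ∑ p ∈ ρ₂, d p • p := (S.sum_split ρ₂ (fun p => d p • p)).symm

/-! ### Affine independence of the faces -/

/-- The straight part of a simplex of `H` is affinely independent. [folklore] -/
theorem affineIndependent_sv {ρ : Finset (𝔼 n)} (hρ : ρ ∈ X.H.faces) :
    AffineIndependent ℝ ((↑) : ↥(S.sv ρ) → (Fin N → ℝ)) := by
  rcases (S.sv ρ).eq_empty_or_nonempty with h | hne
  · rw [h]
    exact affineIndependent_of_subsingleton ℝ _
  · exact S.Kb.indep (X.sv_str hρ hne).1

/-- New faces are affinely independent. [folklore] -/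
theorem affineIndependent_newFace {ρ : Finset (𝔼 n)} (hρ : ρ ∈ X.H.faces) :
    AffineIndependent ℝ ((↑) : ↥(S.newFace ρ) → V₃ n N) := by
  classical
  -- independence of the `ρ`-indexed family
  have hfam : AffineIndependent ℝ (fun i : ↥ρ => S.psi (i : 𝔼 n)) := by
    rw [affineIndependent_iff_of_fintype]
    intro w hw0 hwv
    rw [Finset.weightedVSub_eq_linear_combination _ hw0] at hwv
    set W : 𝔼 n → ℝ := fun p => if h : p ∈ ρ then w ⟨p, h⟩ else 0 with hW
    have hWi : ∀ i : ↥ρ, W i = w i := fun i => by simp [hW, i.2]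
    have hW0 : ∑ p ∈ ρ, W p = 0 := by
      rw [← Finset.sum_coe_sort ρ W]; simp_rw [hWi]; exact hw0
    have hWv : ∑ p ∈ ρ, W p • S.psi p = 0 := by
      rw [← Finset.sum_coe_sort ρ (fun p => W p • S.psi p)]; simp_rw [hWi]; exact hwv
    obtain ⟨h1, h2, h3⟩ := S.components_sum ρ W
    rw [hWv] at h1 h2 h3
    simp only [Prod.fst_zero, Prod.snd_zero] at h1 h2 h3
    have hsplit := S.sum_split ρ W
    rw [hW0, ← h3, zero_add] at hsplit
    -- new part
    have hnw : ∀ p ∈ S.nw ρ, W p = 0 := by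
      have hind : AffineIndependent ℝ ((↑) : ↥(S.nw ρ) → 𝔼 n) :=
        (X.H.indep hρ).mono (by intro p hp; exact (S.mem_nw.1 hp).1)
      exact hind.eq_zero_of_sum_eq_zero_subtype hsplit.symm h2.symm
    -- straight part
    have hsv : ∀ v ∈ S.sv ρ, W (S.Λ v) = 0 :=
      (X.affineIndependent_sv hρ).eq_zero_of_sum_eq_zero_subtype (w := fun v => W (S.Λ v)) h3.symm h1.symm
    intro i
    rw [← hWi i]
    by_cases h : ∃ v, v ∈ S.StrVert ∧ S.Λ v = (i : 𝔼 n)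
    · obtain ⟨v, hv, hvi⟩ := h
      rw [← hvi]
      exact hsv v (S.mem_sv.2 ⟨hv, hvi ▸ i.2⟩)
    · exact hnw i (S.mem_nw.2 ⟨i.2, h⟩)
  have hrange : Set.range (fun i : ↥ρ => S.psi (i : 𝔼 n)) = ((S.newFace ρ : Finset (V₃ n N)) : Set (V₃ n N)) := by
    ext x
    simp only [Set.mem_range, newFace, Finset.coe_image, Set.mem_image, Finset.mem_coe, Subtype.exists, exists_prop]
  have h := hfam.range
  rw [hrange] at h
  exact h

/-! ### Intersections of closed faces -/

/-- **Old/new intersections.** [folklore] -/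
theorem inter_old_new {σ : Finset (Fin N → ℝ)} (hσ : σ ∈ S.Kb.faces) {ρ : Finset (𝔼 n)} (hρ : ρ ∈ X.H.faces) :
    convexHull ℝ ((S.oldFace σ : Finset (V₃ n N)) : Set (V₃ n N)) ∩ convexHull ℝ ((S.newFace ρ : Finset (V₃ n N)) : Set (V₃ n N)) ⊆
      convexHull ℝ ((↑(S.oldFace σ ∩ S.newFace ρ)) : Set (V₃ n N)) := by
  classical
  rintro x ⟨hxo, hxn⟩
  obtain ⟨w, hw, rfl⟩ := S.mem_convexHull_oldFace_iff.1 hxo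
  obtain ⟨c, hc0, hc1, hcx⟩ := S.exists_rep_of_mem_convexHull_newFace hxn
  obtain ⟨h1, -, h3⟩ := S.components_sum ρ c
  rw [hcx] at h1 h3
  simp only [oldV_fst, oldV_snd_snd] at h1 h3
  -- the straight coefficients sum to `1`; so `w ∈ conv (sv ρ)`
  have hcv0 : ∀ v ∈ S.sv ρ, 0 ≤ c (S.Λ v) := fun v hv => hc0 _ (S.mem_sv.1 hv).2
  have hne : (S.sv ρ).Nonempty := by
    by_contra h; rw [Finset.not_nonempty_iff_eq_empty] at h
    rw [h, Finset.sum_empty] at h3; exact one_ne_zero h3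
  have hwsv : w ∈ convexHull ℝ ((S.sv ρ : Finset (Fin N → ℝ)) : Set (Fin N → ℝ)) := by
    rw [h1]
    exact (convex_convexHull ℝ _).sum_mem hcv0 h3.symm fun v hv => subset_convexHull ℝ _ hv
  obtain ⟨u₀, hu₀, hsub⟩ := X.exists_superset_sv hρ hne
  -- `w ∈ conv σ ∩ conv u₀ ⊆ conv (σ ∩ u₀)`, then inside the simplex `u₀`
  have hw1 : w ∈ convexHull ℝ (↑(σ ∩ u₀) : Set (Fin N → ℝ)) := by
    rw [Finset.coe_inter]
    exact S.Kb.inter_subset_convexHull hσ hu₀.1 ⟨hw, convexHull_mono (by exact_mod_cast hsub) hwsv⟩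
  have hw2 : w ∈ convexHull ℝ (↑(σ ∩ u₀ ∩ S.sv ρ) : Set (Fin N → ℝ)) := by
    rw [Finset.coe_inter, (S.Kb.indep hu₀.1).convexHull_inter Finset.inter_subset_right hsub]
    exact ⟨hw1, hwsv⟩
  have hsub2 : σ ∩ u₀ ∩ S.sv ρ ⊆ σ ∩ S.sv ρ := by
    intro v hv; simp only [Finset.mem_inter] at hv ⊢; exact ⟨hv.1.1, hv.2⟩
  have hw3 : w ∈ convexHull ℝ (↑(σ ∩ S.sv ρ) : Set (Fin N → ℝ)) := convexHull_mono (by exact_mod_cast hsub2) hw2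
  -- lift
  have hlift : oldV w ∈ convexHull ℝ ((S.oldFace (σ ∩ S.sv ρ) : Finset (V₃ n N)) : Set (V₃ n N)) :=
    S.mem_convexHull_oldFace_iff.2 ⟨w, hw3, rfl⟩
  refine convexHull_mono ?_ hlift
  intro y hy
  obtain ⟨v, hv, rfl⟩ := S.mem_oldFace.1 hy
  rw [Finset.mem_inter] at hv
  rw [Finset.mem_coe, Finset.mem_inter]
  exact ⟨S.mem_oldFace.2 ⟨v, hv.1, rfl⟩, (S.oldV_mem_newFace_iff (S.mem_sv.1 hv.2).1).2 (S.mem_sv.1 hv.2).2⟩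

/-- **New/new intersections.** [folklore] -/
theorem inter_new_new {ρ₁ ρ₂ : Finset (𝔼 n)} (h₁ : ρ₁ ∈ X.H.faces) (h₂ : ρ₂ ∈ X.H.faces) :
    convexHull ℝ ((S.newFace ρ₁ : Finset (V₃ n N)) : Set (V₃ n N)) ∩ convexHull ℝ ((S.newFace ρ₂ : Finset (V₃ n N)) : Set (V₃ n N)) ⊆
      convexHull ℝ ((↑(S.newFace ρ₁ ∩ S.newFace ρ₂)) : Set (V₃ n N)) := by
  classical
  rintro x ⟨hx₁, hx₂⟩
  obtain ⟨c, hc0, hc1, hcx⟩ := S.exists_rep_of_mem_convexHull_newFace hx₁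
  obtain ⟨d, hd0, hd1, hdx⟩ := S.exists_rep_of_mem_convexHull_newFace hx₂
  have hh : ∑ p ∈ ρ₁, c p • p = ∑ p ∈ ρ₂, d p • p := X.hval_eq h₁ h₂ hc0 hd0 (by rw [hcx, hdx])
  -- the common chart value lies in `conv (ρ₁ ∩ ρ₂)`
  have hmem₁ : ∑ p ∈ ρ₁, c p • p ∈ convexHull ℝ (ρ₁ : Set (𝔼 n)) :=
    (convex_convexHull ℝ _).sum_mem hc0 hc1 fun p hp => subset_convexHull ℝ _ hp
  have hmem₂ : ∑ p ∈ ρ₁, c p • p ∈ convexHull ℝ (ρ₂ : Set (𝔼 n)) := by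
    rw [hh]; exact (convex_convexHull ℝ _).sum_mem hd0 hd1 fun p hp => subset_convexHull ℝ _ hp
  have hmem : ∑ p ∈ ρ₁, c p • p ∈ convexHull ℝ (↑(ρ₁ ∩ ρ₂) : Set (𝔼 n)) := by
    rw [Finset.coe_inter]; exact X.H.inter_subset_convexHull h₁ h₂ ⟨hmem₁, hmem₂⟩
  obtain ⟨e, he0, he1, hex⟩ := Finset.mem_convexHull'.1 hmem
  -- compare the two representations over `ρ₁`
  set e' : 𝔼 n → ℝ := fun p => if p ∈ ρ₂ then e p else 0 with he'
  have hsum_e' : ∀ g : 𝔼 n → 𝔼 n, ∑ p ∈ ρ₁, e' p • g p = ∑ p ∈ ρ₁ ∩ ρ₂, e p • g p := fun g => by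
    rw [← Finset.sum_filter_add_sum_filter_not ρ₁ (fun p => p ∈ ρ₂)]
    have hz : ∑ p ∈ ρ₁.filter (fun p => p ∉ ρ₂), e' p • g p = 0 :=
      Finset.sum_eq_zero fun p hp => by simp [he', (Finset.mem_filter.1 hp).2]
    rw [hz, add_zero, Finset.filter_mem_eq_inter]
    exact Finset.sum_congr rfl fun p hp => by simp [he', (Finset.mem_inter.1 hp).2]
  have hsum_e'1 : ∑ p ∈ ρ₁, e' p = 1 := by
    rw [← Finset.sum_filter_add_sum_filter_not ρ₁ (fun p => p ∈ ρ₂)]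
    have hz : ∑ p ∈ ρ₁.filter (fun p => p ∉ ρ₂), e' p = 0 :=
      Finset.sum_eq_zero fun p hp => by simp [he', (Finset.mem_filter.1 hp).2]
    rw [hz, add_zero, Finset.filter_mem_eq_inter, ← he1]
    exact Finset.sum_congr rfl fun p hp => by simp [he', (Finset.mem_inter.1 hp).2]
  have hce : ∀ p ∈ ρ₁, c p = e' p := by
    refine (X.H.indep h₁).eq_of_sum_eq_sum_subtype (by rw [hc1, hsum_e'1]) ?_
    have h := hsum_e' id
    simp only [id] at h
    rw [h]
    exact hex.symm
  -- hence `c` vanishes off `ρ₂` and `x ∈ conv (newFace (ρ₁ ∩ ρ₂))`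
  have hx : x = ∑ p ∈ ρ₁ ∩ ρ₂, c p • S.psi p := by
    rw [← hcx, ← Finset.sum_filter_add_sum_filter_not ρ₁ (fun p => p ∈ ρ₂), Finset.filter_mem_eq_inter]
    have hz : ∑ p ∈ ρ₁.filter (fun p => p ∉ ρ₂), c p • S.psi p = 0 :=
      Finset.sum_eq_zero fun p hp => by
        rw [hce p (Finset.mem_filter.1 hp).1]; simp [he', (Finset.mem_filter.1 hp).2]
    rw [hz, add_zero]
  have hc1' : ∑ p ∈ ρ₁ ∩ ρ₂, c p = 1 := by
    rw [← hc1, ← Finset.sum_filter_add_sum_filter_not ρ₁ (fun p => p ∈ ρ₂), Finset.filter_mem_eq_inter]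
    have hz : ∑ p ∈ ρ₁.filter (fun p => p ∉ ρ₂), c p = 0 :=
      Finset.sum_eq_zero fun p hp => by rw [hce p (Finset.mem_filter.1 hp).1]; simp [he', (Finset.mem_filter.1 hp).2]
    rw [hz, add_zero]
  rw [← newFace_inter, hx]
  exact S.sum_mem_convexHull_newFace (fun p hp => hc0 p (Finset.mem_inter.1 hp).1) hc1'

/-! ### The glued complex -/

/-- **The glued complex `G₃`** in `V₃`. [folklore] -/
def G₃ : Geometry.SimplicialComplex ℝ (V₃ n N) where
  faces := X.G₃faces
  indep := by
    rintro T (⟨σ, hσ, rfl⟩ | ⟨ρ, hρ, rfl⟩)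
    · exact S.affineIndependent_oldFace hσ.1
    · exact X.affineIndependent_newFace hρ
  isRelLowerSet_faces := by
    classical
    rintro T (⟨σ, hσ, rfl⟩ | ⟨ρ, hρ, rfl⟩)
    · refine ⟨(S.Kb.nonempty_of_mem_faces hσ.1).image _, fun T' hT' hne => ?_⟩
      -- `T' = oldFace σ'` with `σ' = {v ∈ σ | oldV v ∈ T'}`
      refine Or.inl ⟨σ.filter fun v => oldV v ∈ T', X.u_down σ hσ _ (Finset.filter_subset _ _) ?_, ?_⟩
      · obtain ⟨y, hy⟩ := hne
        obtain ⟨v, hv, rfl⟩ := S.mem_oldFace.1 (hT' hy)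
        exact ⟨v, Finset.mem_filter.2 ⟨hv, hy⟩⟩
      · ext y
        simp only [oldFace, Finset.mem_image, Finset.mem_filter]
        constructor
        · rintro ⟨v, ⟨-, hvT⟩, rfl⟩; exact hvT
        · intro hy
          obtain ⟨v, hv, rfl⟩ := S.mem_oldFace.1 (hT' hy)
          exact ⟨v, ⟨hv, hy⟩, rfl⟩
    · refine ⟨(X.H.nonempty_of_mem_faces hρ).image _, fun T' hT' hne => ?_⟩
      refine Or.inr ⟨ρ.filter fun p => S.psi p ∈ T', X.H.down_closed hρ (Finset.filter_subset _ _) ?_, ?_⟩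
      · obtain ⟨y, hy⟩ := hne
        obtain ⟨p, hp, rfl⟩ := S.mem_newFace.1 (hT' hy)
        exact ⟨p, Finset.mem_filter.2 ⟨hp, hy⟩⟩
      · ext y
        simp only [newFace, Finset.mem_image, Finset.mem_filter]
        constructor
        · rintro ⟨p, ⟨-, hpT⟩, rfl⟩; exact hpT
        · intro hy
          obtain ⟨p, hp, rfl⟩ := S.mem_newFace.1 (hT' hy)
          exact ⟨p, ⟨hp, hy⟩, rfl⟩
  inter_subset_convexHull := by
    classical
    rintro T₁ T₂ (⟨σ₁, hσ₁, rfl⟩ | ⟨ρ₁, hρ₁, rfl⟩) (⟨σ₂, hσ₂, rfl⟩ | ⟨ρ₂, hρ₂, rfl⟩)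
    · rw [← Finset.coe_inter]; exact S.inter_old_old hσ₁.1 hσ₂.1
    · rw [← Finset.coe_inter]; exact X.inter_old_new hσ₁.1 hρ₂
    · intro x hx
      have h := X.inter_old_new hσ₂.1 hρ₁ ⟨hx.2, hx.1⟩
      rw [Finset.inter_comm] at h
      rw [← Finset.coe_inter]; exact h
    · rw [← Finset.coe_inter]; exact X.inter_new_new hρ₁ hρ₂

/-- Auxiliary (`mem_G₃_faces`). [folklore] -/
theorem mem_G₃_faces {T : Finset (V₃ n N)} :
    T ∈ X.G₃.faces ↔ (∃ σ ∈ X.U, S.oldFace σ = T) ∨ ∃ ρ ∈ X.H.faces, S.newFace ρ = T := Iff.rfl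

/-- Auxiliary (`oldFace_mem_G₃`). [folklore] -/
theorem oldFace_mem_G₃ {σ : Finset (Fin N → ℝ)} (hσ : σ ∈ X.U) : S.oldFace σ ∈ X.G₃.faces := Or.inl ⟨σ, hσ, rfl⟩

/-- Auxiliary (`newFace_mem_G₃`). [folklore] -/
theorem newFace_mem_G₃ {ρ : Finset (𝔼 n)} (hρ : ρ ∈ X.H.faces) : S.newFace ρ ∈ X.G₃.faces := Or.inr ⟨ρ, hρ, rfl⟩

/-- `G₃` is finite. [folklore] -/
theorem G₃_finite : X.G₃.faces.Finite :=
  ((S.Kb_finite.subset X.u_subset).image _).union (X.H_finite.image _)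

end ExtInput

end BendSetup

end BendInput

end Literature.Topology.FourManifolds
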